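import Summits.KontsevichZagierPeriods.KontsevichZagierPeriods.Theorems.AperySectorThreeTwo.Negative.Kit

/-!
# `AperySectorThreeTwo` (stmt-KontsevichZagierPeriods-3873): negative side II — the load-bearing
# hypothesis and refuted strengthenings

Companion of `Negative/Kit.lean` (cdisprove unit of the crux `AperySectorThreeTwo`, route
`HurwitzMicroSectors`). PROVED here:

* §2 the value hypothesis `r.value = r'.value` is load-bearing — ANY proof must use it:
  `aperySectorThreeTwo_false_without_value` (`[box, 0]` and `[box, 1]`, i.e. `P = 0`,
  `P' = 1 − X²`, lie in the sector with values `0 ≠ 1`; soundness `KZ.Equivalent.value_eq_holds`).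
  The two domain clauses and the two `EqOn` clauses are scope restrictions, not load-bearing for
  truth: deleting them gives larger sub-cases of Conjecture 1 (for `ℚ`-semialgebraic integrands),
  for which no refutation by value exists — no theorem is possible there.
* §3 refuted NATURAL STRENGTHENINGS: equal values force neither equal integrands on the box
  (`not_aperySectorThreeTwoEqOn`) nor equal numerators (`not_aperySectorThreeTwoInjective`):
  `[box, 1]` and `[box, 8t]` (`P = 1 − X²`, `P' = 8X − 8X³`) both have value `1`
  (`value_one_eq_value_eightT`). Rigidity holds only AFTER reduction to the normal form
  `a + b/(1 − t)`, exactly as the route says.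

Sources: M. Kontsevich, D. Zagier, *Periods* (2001), §1.2.
-/

noncomputable section

open MeasureTheory Set MvPolynomial intervalIntegral
open Literature.NumberTheory.Transcendental Literature.ModelTheory.ExponentialFields

namespace Summit.KontsevichZagierPeriods.Theorems.AperySectorThreeTwo.Negative

open Summit.KontsevichZagierPeriods.KontsevichZagierPeriods.Theses.HurwitzMicroSectors
  (AperySectorThreeTwo)

/-! ## §2 Load-bearing hypotheses -/

/-- The crux with the value hypothesis `r.value = r'.value` DELETED (everything else verbatim);
refuted below (a statement variant of this file, not a literature fact). -/
def AperySectorThreeTwoWithoutValue : Prop :=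
  ∀ (r r' : KZ.IntegralRep 3) (P P' : Polynomial ℚ), r.domain = ubox → r'.domain = ubox →
    EqOn r.integrand (fun x => Polynomial.aeval (x 0 * x 1 * x 2) P / (1 - (x 0 * x 1 * x 2) ^ 2)) r.domain →
    EqOn r'.integrand (fun x => Polynomial.aeval (x 0 * x 1 * x 2) P' / (1 - (x 0 * x 1 * x 2) ^ 2)) r'.domain →
    KZ.Equivalent r r'

/-- The value hypothesis is load-bearing ("any proof must use it"): `[box, 0]` and `[box, 1]`
(`P = 0`, `P' = 1 − X²`) lie in the sector with values `0 ≠ 1`, and the calculus is sound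
(`KZ.Equivalent.value_eq_holds`). [folklore] -/
theorem aperySectorThreeTwo_false_without_value : ¬ AperySectorThreeTwoWithoutValue := by
  intro h
  have he := h (polyRep (Polynomial.C 0)) (polyRep (Polynomial.C 1)) _ _ rfl rfl
    (polyRep_eqOn _) (polyRep_eqOn _)
  have hv := KZ.Equivalent.value_eq_holds he
  rw [value_polyRep_C, value_polyRep_C] at hv
  norm_num at hv

/-! ## §3 Refuted natural strengthenings -/

/-- Strengthening I: equal values force the integrands to agree on the box; refuted below
(a statement variant of this file, not a literature fact). -/
def AperySectorThreeTwoEqOn : Prop :=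
  ∀ (r r' : KZ.IntegralRep 3) (P P' : Polynomial ℚ), r.domain = ubox → r'.domain = ubox →
    EqOn r.integrand (fun x => Polynomial.aeval (x 0 * x 1 * x 2) P / (1 - (x 0 * x 1 * x 2) ^ 2)) r.domain →
    EqOn r'.integrand (fun x => Polynomial.aeval (x 0 * x 1 * x 2) P' / (1 - (x 0 * x 1 * x 2) ^ 2)) r'.domain →
    r.value = r'.value → EqOn r.integrand r'.integrand ubox

/-- Strengthening II: equal values force equal numerators `P = P'`; refuted below
(a statement variant of this file, not a literature fact). -/
def AperySectorThreeTwoInjective : Prop :=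
  ∀ (r r' : KZ.IntegralRep 3) (P P' : Polynomial ℚ), r.domain = ubox → r'.domain = ubox →
    EqOn r.integrand (fun x => Polynomial.aeval (x 0 * x 1 * x 2) P / (1 - (x 0 * x 1 * x 2) ^ 2)) r.domain →
    EqOn r'.integrand (fun x => Polynomial.aeval (x 0 * x 1 * x 2) P' / (1 - (x 0 * x 1 * x 2) ^ 2)) r'.domain →
    r.value = r'.value → P = P'

/-- The equal-value pair `[box, 1]`, `[box, 8·x₀x₁x₂]` (values `1 = 8/2³`). [folklore] -/
theorem value_one_eq_value_eightT :
    (polyRep (Polynomial.C 1)).value = (polyRep (Polynomial.C 8 * Polynomial.X ^ 1)).value := by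
  rw [value_polyRep_C, value_polyRep_monomial]
  norm_num

/-- Strengthening I is FALSE: `[box, 1]` and `[box, 8t]` have equal values and different
integrands (at `x = (¼,¼,¼)`, `8t = 1/8 ≠ 1`). So the value map is not injective on the sector:
rigidity holds only AFTER reduction to normal form. [folklore] -/
theorem not_aperySectorThreeTwoEqOn : ¬ AperySectorThreeTwoEqOn := by
  intro h
  have heq := h (polyRep (Polynomial.C 1)) (polyRep (Polynomial.C 8 * Polynomial.X ^ 1)) _ _ rfl rfl
    (polyRep_eqOn _) (polyRep_eqOn _) value_one_eq_value_eightT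
  have hx : (fun _ => (1/4 : ℝ) : Fin 3 → ℝ) ∈ ubox := fun i => by norm_num
  have := heq hx
  simp at this
  norm_num at this

/-- Strengthening II is FALSE (same pair: `P = 1 − X²`, `P' = 8X(1 − X²)`). [folklore] -/
theorem not_aperySectorThreeTwoInjective : ¬ AperySectorThreeTwoInjective := by
  intro h
  have heq := h (polyRep (Polynomial.C 1)) (polyRep (Polynomial.C 8 * Polynomial.X ^ 1)) _ _ rfl rfl
    (polyRep_eqOn _) (polyRep_eqOn _) value_one_eq_value_eightT
  have := congrArg (Polynomial.eval 0) heq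
  simp at this

end Summit.KontsevichZagierPeriods.Theorems.AperySectorThreeTwo.Negative

end
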